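import Literature.Probability.Percolation.PercolationProofs
import Summits.CriticalPhenomena.PercolationContinuityZ3.Theorems.AdditiveGluing.Negative.CertIsoSeven

/-!
# `NoHeavyLowerTail` (crux stmt-CriticalPhenomena-4575 ≡ KN Conjecture 3), certificate programme:
# the crux's OWN lower-tail forms on every simple graph with at most seven vertices at density `1/2`

The crux bounds the lower tail of `N = |C(o) ∩ A|`.  Its two finitely-checkable linear proxies
(Disproof §D.1 of the crux's disprover, there derived instance-wise from `AdditiveGluing` for the
SAME weights) are

* the HUB form `P({o ↔ A} ∖ {o ↔ a₀}) ≤ η` whenever `a₀ ∈ A` and `P(a ↔ a₀) ≥ 1 − η` on `A`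
  (`reachDiff_half_le_seven`);
* the LINEAR lower-tail form `P(1 ≤ N < EN/2) ≤ 3 · (P(o ↮ A) + η)` whenever
  `P(a ↮ a') ≤ η` on `A × A` (`linearLowerTail_half_le_seven`).

Here the additive-gluing input is the kernel-checked window certificate
`additiveGluing_half_le_seven` (`CertIsoSeven.lean`: every simple graph on `Fin n`, `n ≤ 7`, Bernoulli
bond percolation with density `1/2`), so both forms hold on that window unconditionally.  The proofs
are the measure-generic ports of Disproof §D.1: the hub form is `measureReal_sdiff` plus additivity with
`b := a₀`; the linear form splits on `{o ↔ a₀}` — on it `N` is the own count of `a₀` and first-moment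
counting (`halfLeSevenForms_ownCount_lowerTail_le`) gives `≤ 2η` since `EN ≤ |A|`, off it the event
lies in `{o ↔ A} ∖ {o ↔ a₀}` (`≤ η` by the hub form).

Nothing here asserts or refutes the crux.
-/

namespace Summit.CriticalPhenomena.PercolationContinuityZ3.Theorems

open MeasureTheory
open Literature.Probability.LatticeModels Literature.Probability.Percolation
open Summit.CriticalPhenomena.PercolationContinuityZ3.Theorems.AdditiveGluing.Negative.Cert

/-! ### Toolkit: measurability and first-moment counting -/

/-- Every event of bond configurations on `Fin n` is measurable (the configuration space
`Set (Sym2 (Fin n))` is finite with measurable singletons). [folklore] -/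
theorem halfLeSevenForms_measurableSet_config {n : ℕ} (S : Set (Set (Sym2 (Fin n)))) :
    MeasurableSet S :=
  S.toFinite.measurableSet

/-- **First-moment counting (finite Markov inequality without integrals in the statement).**
If every point of `S` lies in at least `c` of the events `E k`, `k ∈ s`, then
`c · μ(S) ≤ ∑_{k ∈ s} μ(S ∩ E k)`. [folklore] -/
theorem halfLeSevenForms_mul_measureReal_le_sum_inter {α κ : Type*} [MeasurableSpace α]
    (μ : Measure α) [IsFiniteMeasure μ] (s : Finset κ) (E : κ → Set α)
    (hE : ∀ k ∈ s, MeasurableSet (E k)) {S : Set α} (hS : MeasurableSet S) (c : ℝ)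
    (hc : ∀ ω ∈ S, c ≤ ∑ k ∈ s, (E k).indicator (fun _ => (1 : ℝ)) ω) :
    c * μ.real S ≤ ∑ k ∈ s, μ.real (S ∩ E k) := by
  have hint : ∀ k ∈ s, Integrable ((S ∩ E k).indicator fun _ => (1 : ℝ)) μ :=
    fun k hk => (integrable_const (1 : ℝ)).indicator (hS.inter (hE k hk))
  have h1 : ∀ k ∈ s, μ.real (S ∩ E k) = ∫ ω, (S ∩ E k).indicator (fun _ => (1 : ℝ)) ω ∂μ := by
    intro k hk
    rw [integral_indicator_const _ (hS.inter (hE k hk)), smul_eq_mul, mul_one]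
  have h2 : c * μ.real S = ∫ ω, S.indicator (fun _ => c) ω ∂μ := by
    rw [integral_indicator_const _ hS, smul_eq_mul, mul_comm]
  rw [h2, Finset.sum_congr rfl h1, ← integral_finsetSum s hint]
  refine integral_mono ((integrable_const c).indicator hS) (integrable_finsetSum s hint) ?_
  intro ω
  by_cases hω : ω ∈ S
  · simp only [Set.indicator_of_mem hω]
    refine le_trans (hc ω hω) (le_of_eq (Finset.sum_congr rfl fun k _ => ?_))
    by_cases hk : ω ∈ E k
    · rw [Set.indicator_of_mem hk, Set.indicator_of_mem (Set.mem_inter hω hk)]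
    · rw [Set.indicator_of_notMem hk, Set.indicator_of_notMem (fun h => hk h.2)]
  · simp only [Set.indicator_of_notMem hω]
    exact Finset.sum_nonneg fun k _ => Set.indicator_nonneg (fun _ _ => zero_le_one) _

/-- Counting form: the number of events containing `ω`, as a real number, is the sum of the
indicators. [folklore] -/
theorem halfLeSevenForms_card_filter_eq_sum_indicator {α κ : Type*} (s : Finset κ)
    (E : κ → Set α) (ω : α) [DecidablePred fun k => ω ∈ E k] :
    ((s.filter fun k => ω ∈ E k).card : ℝ) = ∑ k ∈ s, (E k).indicator (fun _ => (1 : ℝ)) ω := by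
  rw [Finset.natCast_card_filter]
  refine Finset.sum_congr rfl fun k _ => ?_
  by_cases hk : ω ∈ E k
  · rw [if_pos hk, Set.indicator_of_mem hk]
  · rw [if_neg hk, Set.indicator_of_notMem hk]

open scoped Classical in
/-- **Counting bound for the own count of a reliable relay point** (density `1/2` on a simple
graph `G`). If `P(a₀ ↮ a) ≤ η` for all `a ∈ A` then
`(|A| − τ) · P(#{a ∈ A : a₀ ↔ a} < τ) ≤ |A| · η`. [folklore] -/
theorem halfLeSevenForms_ownCount_lowerTail_le {n : ℕ} (G : SimpleGraph (Fin n))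
    (A : Finset (Fin n)) (a₀ : Fin n) (η τ : ℝ)
    (hη : ∀ a ∈ A, (bondPercolation G half).real (openConn a₀ a)ᶜ ≤ η) :
    ((A.card : ℝ) - τ) * (bondPercolation G half).real
        {ω | ((A.filter fun a => ω ∈ openConn a₀ a).card : ℝ) < τ} ≤ A.card * η := by
  classical
  set P := bondPercolation G half with hP
  calc ((A.card : ℝ) - τ) * P.real {ω | ((A.filter fun a => ω ∈ openConn a₀ a).card : ℝ) < τ}
      ≤ ∑ a ∈ A, P.real ({ω | ((A.filter fun a => ω ∈ openConn a₀ a).card : ℝ) < τ} ∩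
          (openConn a₀ a)ᶜ) := by
        refine halfLeSevenForms_mul_measureReal_le_sum_inter P A (fun a => (openConn a₀ a)ᶜ)
          (fun a _ => halfLeSevenForms_measurableSet_config _)
          (halfLeSevenForms_measurableSet_config _) _ fun ω hω => ?_
        rw [← halfLeSevenForms_card_filter_eq_sum_indicator]
        have hsplit := Finset.card_filter_add_card_filter_not (s := A) (fun a => ω ∈ openConn a₀ a)
        have hω' : ((A.filter fun a => ω ∈ openConn a₀ a).card : ℝ) < τ := hω
        have hcast : ((A.filter fun a => ω ∈ openConn a₀ a).card : ℝ)
            + ((A.filter fun a => ¬ ω ∈ openConn a₀ a).card : ℝ) = A.card := by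
          exact_mod_cast hsplit
        have : ((A.filter fun a => ω ∈ (openConn a₀ a)ᶜ).card : ℝ)
            = ((A.filter fun a => ¬ ω ∈ openConn a₀ a).card : ℝ) := rfl
        linarith
    _ ≤ ∑ a ∈ A, P.real (openConn a₀ a)ᶜ :=
        Finset.sum_le_sum fun a _ => measureReal_mono Set.inter_subset_right
    _ ≤ ∑ a ∈ A, η := Finset.sum_le_sum fun a ha => hη a ha
    _ = A.card * η := by simp

/-! ### The hub form on the window `n ≤ 7`, `p = 1/2` -/

/-- **Hub form of the lower tail (density `1/2`, at most seven vertices).** For every simple graph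
`G` on `Fin n`, `n ≤ 7`, under Bernoulli bond percolation with density `1/2`: if `a₀ ∈ A` and
`P(a ↔ a₀) ≥ 1 − η` for all `a ∈ A`, then `o` meets `A` but misses `a₀` with probability at most
`η`: `P({o ↔ A} ∖ {o ↔ a₀}) = P(o ↔ A) − P(o ↔ a₀) ≤ η`, by the certificate
`additiveGluing_half_le_seven` with `b := a₀`. [folklore] -/
theorem reachDiff_half_le_seven : ∀ (n : ℕ), n ≤ 7 → ∀ (G : SimpleGraph (Fin n)) (A : Finset (Fin n)) (o a₀ : Fin n) (η : ℝ), a₀ ∈ A → (∀ a ∈ A, 1 - η ≤ (Literature.Probability.Percolation.bondPercolation G Literature.Probability.Percolation.half).real (Literature.Probability.Percolation.openConn a a₀)) → (Literature.Probability.Percolation.bondPercolation G Literature.Probability.Percolation.half).real ((⋃ a ∈ A, Literature.Probability.Percolation.openConn o a) \ Literature.Probability.Percolation.openConn o a₀) ≤ η := by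
  intro n hn G A o a₀ η ha₀ hη
  have hsub : openConn o a₀ ⊆ ⋃ a ∈ A, openConn o a :=
    fun ω hω => Set.mem_biUnion (Finset.mem_coe.2 ha₀) hω
  have hη0 : 0 ≤ η := by
    have := hη a₀ ha₀
    linarith [(measureReal_le_one : (bondPercolation G half).real (openConn a₀ a₀) ≤ 1)]
  have h1 := additiveGluing_half_le_seven hn G A o a₀ η hη0 hη
  rw [measureReal_sdiff hsub (halfLeSevenForms_measurableSet_config _) (measure_ne_top _ _)]
  linarith

/-! ### The linear lower-tail form on the window `n ≤ 7`, `p = 1/2` -/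

open Classical in
/-- **Linear lower-tail form with constant `3` (density `1/2`, at most seven vertices).** For every
simple graph `G` on `Fin n`, `n ≤ 7`, under Bernoulli bond percolation with density `1/2`: if
`P(a ↮ a') ≤ η` for all `a, a' ∈ A` then, with `N = #{a ∈ A : o ↔ a}` and `EN = ∑_{a ∈ A} P(o ↔ a)`,
`P(1 ≤ N < EN/2) ≤ 3 · (P(o ↮ A) + η)` (even without the `P(o ↮ A)` term): `2η` from first-moment
counting of the own count of a hub `a₀ ∈ A` on `{o ↔ a₀}` (there `N = #{a ∈ A : a₀ ↔ a}` and
`EN/2 ≤ |A|/2`), plus `η` from the hub form `reachDiff_half_le_seven` on `{o ↮ a₀}`. [folklore] -/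
theorem linearLowerTail_half_le_seven : ∀ (n : ℕ), n ≤ 7 → ∀ (G : SimpleGraph (Fin n)) (A : Finset (Fin n)) (o : Fin n) (η : ℝ), 0 ≤ η → (∀ a ∈ A, ∀ a' ∈ A, (Literature.Probability.Percolation.bondPercolation G Literature.Probability.Percolation.half).real (Literature.Probability.Percolation.openConn a a')ᶜ ≤ η) → (Literature.Probability.Percolation.bondPercolation G Literature.Probability.Percolation.half).real {ω | 1 ≤ (A.filter fun a => ω ∈ Literature.Probability.Percolation.openConn o a).card ∧ ((A.filter fun a => ω ∈ Literature.Probability.Percolation.openConn o a).card : ℝ) < (∑ a ∈ A, (Literature.Probability.Percolation.bondPercolation G Literature.Probability.Percolation.half).real (Literature.Probability.Percolation.openConn o a)) / 2} ≤ 3 * ((Literature.Probability.Percolation.bondPercolation G Literature.Probability.Percolation.half).real (⋃ a ∈ A, Literature.Probability.Percolation.openConn o a)ᶜ + η) := by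
  intro n hn G A o η hη0 hη
  set P := bondPercolation G half with hP
  rcases A.eq_empty_or_nonempty with hAe | ⟨a₀, ha₀⟩
  · subst hAe
    have : P.real {ω | 1 ≤ ((∅ : Finset (Fin n)).filter fun a => ω ∈ openConn o a).card ∧
        (((∅ : Finset (Fin n)).filter fun a => ω ∈ openConn o a).card : ℝ) <
          (∑ a ∈ (∅ : Finset (Fin n)), P.real (openConn o a)) / 2} ≤ P.real (∅ : Set _) :=
      measureReal_mono (fun ω hω => by simp at hω) (measure_ne_top _ _)
    simp only [measureReal_empty] at this
    have h0 : 0 ≤ P.real (⋃ a ∈ (∅ : Finset (Fin n)), openConn o a)ᶜ := measureReal_nonneg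
    nlinarith [this]
  set M : ℕ := A.card with hM
  set EN : ℝ := ∑ a ∈ A, P.real (openConn o a) with hEN
  have hENle : EN ≤ M := by
    calc EN ≤ ∑ a ∈ A, (1 : ℝ) := Finset.sum_le_sum fun a _ => measureReal_le_one
      _ = M := by simp [hM]
  have hMpos : (1 : ℝ) ≤ M := by exact_mod_cast Finset.card_pos.2 ⟨a₀, ha₀⟩
  let S₁ : Set (Set (Sym2 (Fin n))) :=
    {ω | ((A.filter fun a => ω ∈ openConn a₀ a).card : ℝ) < EN / 2}
  have hcount : ((M : ℝ) - EN / 2) * P.real S₁ ≤ M * η :=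
    halfLeSevenForms_ownCount_lowerTail_le G A a₀ η (EN / 2) fun a ha => hη a₀ ha₀ a ha
  have hS₁ : P.real S₁ ≤ 2 * η := by
    have h2 : (M : ℝ) / 2 ≤ M - EN / 2 := by linarith
    have hle : (M : ℝ) * (1 / 2 * P.real S₁) ≤ M * η := by
      calc (M : ℝ) * (1 / 2 * P.real S₁) = M / 2 * P.real S₁ := by ring
        _ ≤ (M - EN / 2) * P.real S₁ := mul_le_mul_of_nonneg_right h2 measureReal_nonneg
        _ ≤ M * η := hcount
    have := le_of_mul_le_mul_left hle (by positivity)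
    linarith
  have hdiff : P.real ((⋃ a ∈ A, openConn o a) \ openConn o a₀) ≤ η := by
    refine reachDiff_half_le_seven n hn G A o a₀ η ha₀ fun a ha => ?_
    have := hη a ha a₀ ha₀
    rw [probReal_compl_eq_one_sub (halfLeSevenForms_measurableSet_config _)] at this
    linarith
  have hUc : 0 ≤ P.real (⋃ a ∈ A, openConn o a)ᶜ := measureReal_nonneg
  refine le_trans (measureReal_mono (s₂ := ((⋃ a ∈ A, openConn o a) \ openConn o a₀) ∪ S₁)
    ?_ (measure_ne_top _ _)) ?_
  · intro ω hω
    simp only [Set.mem_setOf_eq] at hω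
    obtain ⟨h1, h2⟩ := hω
    by_cases ho : ω ∈ openConn o a₀
    · right
      have hfc : (A.filter fun a => ω ∈ openConn o a) = (A.filter fun a => ω ∈ openConn a₀ a) := by
        refine Finset.filter_congr fun a _ => ?_
        simp only [openConn, Set.mem_setOf_eq] at ho ⊢
        exact ⟨fun h => ho.symm.trans h, fun h => ho.trans h⟩
      show ((A.filter fun a => ω ∈ openConn a₀ a).card : ℝ) < EN / 2
      rw [← hfc]
      exact h2
    · left
      refine ⟨?_, ho⟩
      obtain ⟨a, ha⟩ := Finset.card_pos.1 h1
      rw [Finset.mem_filter] at ha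
      exact Set.mem_biUnion (Finset.mem_coe.2 ha.1) ha.2
  · calc P.real (((⋃ a ∈ A, openConn o a) \ openConn o a₀) ∪ S₁)
        ≤ P.real ((⋃ a ∈ A, openConn o a) \ openConn o a₀) + P.real S₁ := measureReal_union_le _ _
      _ ≤ η + 2 * η := add_le_add hdiff hS₁
      _ ≤ 3 * (P.real (⋃ a ∈ A, openConn o a)ᶜ + η) := by nlinarith

end Summit.CriticalPhenomena.PercolationContinuityZ3.Theorems
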